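import Mathlib.Algebra.Field.Basic
import Mathlib.Tactic.LinearCombination
import Mathlib.Tactic.FieldSimp
import Mathlib.Tactic.Ring
import HarnessLib

/-!
# Venture HSemireg — three norm-condition exclusions for degenerate `X₄` on the `H_a`-lift

Seat w1-tw-1 of the computation cell `pub-hsemireg` (W1, CC note §26.9 of
`widen/W1/CLEAN-COMPONENT-THEOREM-w1tw1.md`: PRECISION P-tw1-T16-1 (the edge case of LEMMA (T16)(a)) and
(T17)(i) (the boundary pair `(s₀, β₂)` in the compact convention)).

In the stratum-(II) chart the four lifted points `X₄` of a witness have `u`-polynomial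
`P₄ = u⁴ + p₃u³ + p₂u² + p₁u + p₀`, and membership of `π_* X₄` in the plane `Π_a` of quartics is the pair of
NORM CONDITIONS `e₄ = K_b K_c`, `e₂ = -(K_b + K_c)` on the elementary symmetric functions of the four
`z = u²`-values. Three degenerate configurations are excluded by pure field arithmetic, which is all this file
records (with `K_a, K_b, K_c` the three pairwise distinct parameters of the curve
`Y² = u (u⁴ - K₁)(u⁴ - K₂)(u⁴ - K₃)`):

* `double_weierstrass_pair_excluded` — `X₄ = 2x₁ + 2x₂` with `x₁, x₂` Weierstrass points over `K_b, K_c`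
  (`u₁⁴ = K_b`, `u₂⁴ = K_c`): the `z`-values `{u₁², u₁², u₂², u₂²}` have
  `e₂ = u₁⁴ + u₂⁴ + 4u₁²u₂²`, and `e₂ = -(K_b + K_c)` forces `2 (u₁² + u₂²)² = 0`, hence (away from
  characteristic `2`) `u₁⁴ = u₂⁴`, i.e. `K_b = K_c` — excluded.
* `quadruple_point_excluded` — `X₄ = 4x₁` with `u₁⁴ = K` for `K ∈ {K_a, K_b, K_c}`: `e₄ = K_b K_c` reads
  `K² = K_b K_c`; for `K = K_b` or `K = K_c` this forces `K_b = K_c` (given `K_b K_c ≠ 0`), recorded here; the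
  case `K = K_a` is the numerical inequality `K_a² ≠ K_b K_c` of the member, not a field identity.
* `opposite_weierstrass_constants_excluded` — (T17)(i): `z`-values `{z_x, z_y, ω², -ω²}` with `ω⁴ = K_a`:
  `e₄ = -K_a z_x z_y = K_b K_c` and `e₂ = z_x z_y - K_a = -(K_b + K_c)` force
  `(K_a - K_b)(K_a - K_c) = 0` — excluded for pairwise distinct parameters.

HONEST FRAMING. Elementary identities in a field; no curve, incidence or semiregularity map is formalised;
nothing here says that HC, HC_CM or HC_AV holds, and nothing here is a new case of anything.
-/

namespace Summit.Ventures.HSemireg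

namespace NormConditionExclusions

variable {F : Type*} [Field F]

/-- P-tw1-T16-1, configuration `2x₁ + 2x₂`: if `u₁⁴ = K_b`, `u₂⁴ = K_c` and the second norm condition
`u₁⁴ + u₂⁴ + 4u₁²u₂² = -(K_b + K_c)` holds, then `2 (u₁² + u₂²)² = 0`. -/
theorem two_mul_sq_sum_sq_eq_zero {u₁ u₂ Kb Kc : F} (hb : u₁ ^ 4 = Kb) (hc : u₂ ^ 4 = Kc)
    (h : u₁ ^ 4 + u₂ ^ 4 + 4 * u₁ ^ 2 * u₂ ^ 2 = -(Kb + Kc)) :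
    2 * (u₁ ^ 2 + u₂ ^ 2) ^ 2 = 0 := by
  linear_combination h + hb + hc

/-- P-tw1-T16-1, configuration `2x₁ + 2x₂`: over a field in which `2 ≠ 0`, Weierstrass points `x₁, x₂`
over DISTINCT parameters `K_b ≠ K_c` cannot satisfy the second norm condition. -/
theorem double_weierstrass_pair_excluded (h2 : (2 : F) ≠ 0) {u₁ u₂ Kb Kc : F} (hb : u₁ ^ 4 = Kb)
    (hc : u₂ ^ 4 = Kc) (hne : Kb ≠ Kc)
    (h : u₁ ^ 4 + u₂ ^ 4 + 4 * u₁ ^ 2 * u₂ ^ 2 = -(Kb + Kc)) : False := by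
  have h0 : 2 * (u₁ ^ 2 + u₂ ^ 2) ^ 2 = 0 := two_mul_sq_sum_sq_eq_zero hb hc h
  have hsq : (u₁ ^ 2 + u₂ ^ 2) ^ 2 = 0 := by
    rcases mul_eq_zero.mp h0 with h | h
    · exact absurd h h2
    · exact h
  have hs : u₁ ^ 2 + u₂ ^ 2 = 0 := pow_eq_zero_iff (n := 2) (by norm_num) |>.mp hsq
  have h4 : u₁ ^ 4 = u₂ ^ 4 := by
    have hu : u₁ ^ 2 = -(u₂ ^ 2) := by linear_combination hs
    calc u₁ ^ 4 = (u₁ ^ 2) ^ 2 := by ring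
      _ = (-(u₂ ^ 2)) ^ 2 := by rw [hu]
      _ = u₂ ^ 4 := by ring
  exact hne (by rw [← hb, ← hc, h4])

/-- P-tw1-T16-1, configuration `4x₁` with `x₁` a Weierstrass point over `K_b` (or, symmetrically, `K_c`):
the first norm condition `p₀² = K_b K_c` with `p₀ = u₁⁴ = K_b` forces `K_b = K_c` as soon as `K_b ≠ 0`. -/
theorem quadruple_point_excluded {u₁ Kb Kc : F} (hb : u₁ ^ 4 = Kb) (hKb : Kb ≠ 0) (hne : Kb ≠ Kc)
    (h : (u₁ ^ 4) ^ 2 = Kb * Kc) : False := by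
  rw [hb] at h
  have : Kb * (Kb - Kc) = 0 := by linear_combination h
  rcases mul_eq_zero.mp this with h' | h'
  · exact hKb h'
  · exact hne (sub_eq_zero.mp h')

/-- (T17)(i), sub-case `{c₁, c₂} = {ω², -ω²}` of the boundary pair `(s₀, β₂)`: with `ω⁴ = K_a ≠ 0`, the norm
conditions `e₄ = (z_x z_y)(ω²)(-ω²) = K_b K_c` and `e₂ = z_x z_y + ω²·(-ω²) = -(K_b + K_c)` (the cross terms
`(z_x + z_y)(ω² - ω²)` vanish) imply `(K_a - K_b)(K_a - K_c) = 0`. -/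
theorem opposite_constants_relation {zx zy ω Ka Kb Kc : F} (hω : ω ^ 4 = Ka)
    (h4 : zx * zy * (ω ^ 2 * -(ω ^ 2)) = Kb * Kc)
    (h2 : zx * zy + ω ^ 2 * -(ω ^ 2) = -(Kb + Kc)) : (Ka - Kb) * (Ka - Kc) = 0 := by
  have hω' : ω ^ 2 * -(ω ^ 2) = -Ka := by rw [← hω]; ring
  rw [hω'] at h4 h2
  have hprod : zx * zy = Ka - Kb - Kc := by linear_combination h2
  rw [hprod] at h4
  linear_combination -h4

/-- (T17)(i), conclusion: for pairwise distinct parameters `K_a ≠ K_b`, `K_a ≠ K_c` the sub-case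
`{c₁, c₂} = {ω², -ω²}` of the boundary fibre over `(s₀, β₂)` is EMPTY. -/
theorem opposite_weierstrass_constants_excluded {zx zy ω Ka Kb Kc : F} (hω : ω ^ 4 = Ka)
    (hab : Ka ≠ Kb) (hac : Ka ≠ Kc)
    (h4 : zx * zy * (ω ^ 2 * -(ω ^ 2)) = Kb * Kc)
    (h2 : zx * zy + ω ^ 2 * -(ω ^ 2) = -(Kb + Kc)) : False := by
  rcases mul_eq_zero.mp (opposite_constants_relation hω h4 h2) with h | h
  · exact hab (sub_eq_zero.mp h)
  · exact hac (sub_eq_zero.mp h)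

/-- The member `K = (16, 2, -3)` of the cell: the three numerical inequalities `K_a² ≠ K_b K_c` used by
P-tw1-T16-1 for the configuration `4x₁` with `x₁` over `K_a`, in characteristic `0`. -/
theorem member_Ka_sq_ne_KbKc :
    ((16 : ℚ) ^ 2 ≠ 2 * (-3)) ∧ ((2 : ℚ) ^ 2 ≠ 16 * (-3)) ∧ ((-3 : ℚ) ^ 2 ≠ 16 * 2) := by
  refine ⟨?_, ?_, ?_⟩ <;> norm_num

end NormConditionExclusions

end Summit.Ventures.HSemireg
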